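import Summits.KontsevichZagierPeriods.KontsevichZagierPeriods.Theorems.RootDecompRelativeModAbsoluteCylLogSplitP31

/-! # `RootDecompRelativeModAbsoluteCylLogSplitP32` — part 7/27 of the mechanical ≤400-line split of `RungClosure.lean` (sha256 f909f334226f0fb5…)
Source: decomp-kz lens-3 g12 `RungClosure.lean` v9 (HOME/decomp-kz-lens-3/g12/, sha256 f909f334…; critic g4-52/g4-57/g5 CLEARED, «lander: split v9 --supports 30572»): BLOCK I (57 g11 monolith decls missing from P01–P25), BLOCK II/III (WildCertAssembly parts 1–6, 8–10: `Leaf.cellLocalWildCert`, `Leaf.cylKernelZeroLog_of_trees`), Parts 12–13 (`Leaf.regKernelPairDegOne_iff_circlePos_of_trees`), BLOCK G13 (Möbius engine, test §C decided).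
Split by census-1 g9 `gen/splitlean.py`: scopes re-opened with their `open`/`variable`/`set_option` context; mathematics and declaration order unchanged. -/

noncomputable section
open Set MeasureTheory Filter Topology
open scoped BigOperators
open Literature.NumberTheory.Transcendental Literature.ModelTheory.ExponentialFields
namespace Summit.KontsevichZagierPeriods.RootDecompRelativeModAbsolute.Rung30571
namespace RegularisedLogLayer
namespace CylLog
variable {b : ℕ}

/-- The three elements of `Fin 3` (file-local copy; the public twin lives in an unrelated Literature module). [bookkeeping] -/
private theorem fin3_cases (t : Fin 3) : t = 0 ∨ t = 1 ∨ t = 2 := by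
  fin_cases t <;> simp

open scoped ContDiff in

/-- **A certified wild cell closes** (from `BoundaryRigidity` BY NAME): `cellCloseLS_of_closedCells` with the
engine `wildClose` fed by a `WildCellCert`. -/
theorem cellCloseLS_wild_of_cert
    (hBR : Summit.KontsevichZagierPeriods.LiouvilleUnfolding.LogPrimitiveNL.Negative.BoundaryRigidity)
    (E : Set (Fin 1 → ℝ)) (V : KZ.IntegralRep (1 + 1)) (a₀ : (Fin 1 → ℝ) → ℝ) (q : ℕ)
    (c κ : Fin q → (Fin 1 → ℝ) → ℝ) (M : Fin q → ℕ) (σ : Fin q → Fin 3)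
    (hEo : IsOpen E) (hE : IsSemialgebraic ℚ E)
    (ha₀ : IsSemialgebraicFunOn ℚ E a₀) (ha_sm : ContDiffOn ℝ ∞ a₀ E) (ha₀i : IntegrableOn a₀ E)
    (hc : ∀ i, IsSemialgebraicFunOn ℚ E (c i)) (hc_sm : ∀ i, ContDiffOn ℝ ∞ (c i) E)
    (hκ : ∀ i, IsSemialgebraicFunOn ℚ E (κ i)) (hκ_sm : ∀ i, ContDiffOn ℝ ∞ (κ i) E)
    (hκ1 : ∀ i, ∀ x ∈ E, -1 < κ i x)
    (hσ0 : ∀ i, σ i = 0 → ∀ x ∈ E, 0 < κ i x) (hσ1 : ∀ i, σ i = 1 → ∀ x ∈ E, κ i x < 0)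
    (hσ2 : ∀ i, σ i = 2 → ∀ x ∈ E, κ i x = 0)
    (hint : ∀ i, IntegrableOn (fun z : Fin (1 + 1) → ℝ =>
      c i (Fin.init z) * (z (Fin.last 1) ^ M i / (1 + z (Fin.last 1) * κ i (Fin.init z))))
      {z : Fin (1 + 1) → ℝ | (Fin.init z : Fin 1 → ℝ) ∈ E ∧ z (Fin.last 1) ∈ Set.Ioo 0 1})
    (hL1 : ∀ i, IntegrableOn (fun x => c i x * ∫ θ in Set.Ioo (0 : ℝ) 1, θ ^ M i / (1 + θ * κ i x)) E)
    (hdom : V.domain = {z : Fin (1 + 1) → ℝ | (Fin.init z : Fin 1 → ℝ) ∈ E ∧ z (Fin.last 1) ∈ Set.Ioo 0 1})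
    (hV : Set.EqOn V.integrand (fun z => a₀ (Fin.init z) +
      ∑ i, c i (Fin.init z) * (z (Fin.last 1) ^ M i / (1 + z (Fin.last 1) * κ i (Fin.init z))))
      V.domain)
    (hpoly : ∀ x ∈ E, a₀ x + ∑ i, polyPart (sgnB σ) c κ M i x = 0)
    (hcert : WildCellCert E c κ M σ) :
    KZ.of V ∈ KZ.relations := by
  classical
  obtain ⟨Z, m, a, g, qq, Nn, hMm, hgZ, hrel, hqq, hNn, hcoef, hsumN, hZpow, hZpow', hqpow, hqpow',
    hNpow, hNpow', hL, hintU, hintU', hintV, hintV', hNlog, hNtame⟩ := hcert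
  refine cellCloseLS_of_closedCells E V a₀ q c κ M σ hEo hE ha₀ ha_sm ha₀i hc hc_sm hκ hκ_sm hκ1 hσ0 hσ1
    hσ2 hint hL1 hdom hV hpoly fun P B hPd hPi hBd hBi => ?_
  have hEm : MeasurableSet E := hE.measurableSet_holds
  have h0sa : IsSemialgebraicFunOn ℚ E (fun _ => (0:ℝ)) :=
    (isSemialgebraicFunOn_ratCast hE 0).congr fun _ _ => by simp
  have h1sa : IsSemialgebraicFunOn ℚ E (fun _ => (1:ℝ)) :=
    (isSemialgebraicFunOn_ratCast hE 1).congr fun _ _ => by simp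
  let d : Fin q → (Fin 1 → ℝ) → ℝ := fun i x => c i x / κ i x ^ (M i + 1)
  let W : Fin q → (Fin 1 → ℝ) → ℝ := fun i x => 1 + κ i x
  let σB : Fin q → Bool := fun i => decide (σ i ≠ 1)
  have hWsa : ∀ i, IsSemialgebraicFunOn ℚ E (W i) := fun i => IsSemialgebraicFunOn.add_holds h1sa (hκ i)
  have hκd : ∀ i, DifferentiableOn ℝ (κ i) E := fun i => (hκ_sm i).differentiableOn (by simp)
  have hWd : ∀ i, DifferentiableOn ℝ (W i) E := fun i => (differentiableOn_const _).add (hκd i)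
  have hk0 : ∀ i, σ i ≠ 2 → ∀ x ∈ E, κ i x ≠ 0 := by
    intro i h2 x hx
    rcases fin3_cases (σ i) with h0 | h1 | h2'
    · exact (hσ0 i h0 x hx).ne'
    · exact (hσ1 i h1 x hx).ne
    · exact absurd h2' h2
  have hdsa : ∀ i, IsSemialgebraicFunOn ℚ E (d i) := by
    intro i
    by_cases h2 : σ i = 2
    · refine h0sa.congr fun x hx => ?_
      show (0:ℝ) = c i x / κ i x ^ (M i + 1)
      rw [hσ2 i h2 x hx, zero_pow (Nat.succ_ne_zero _), div_zero]
    · exact IsSemialgebraicFunOn.div (hc i) (isSemialgebraicFunOn_pow' hE (hκ i) (M i + 1))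
        fun x hx => pow_ne_zero _ (hk0 i h2 x hx)
  have hσB1 : ∀ i, σB i = false → σ i = 1 := fun i hi => by simpa [σB] using hi
  have hσBt : ∀ i, σB i = true → σ i ≠ 1 := fun i hi => by simpa [σB] using hi
  have hσt : ∀ i, σB i = true → ∀ x ∈ E, 1 ≤ W i x := by
    intro i hi x hx
    have hne : σ i ≠ 1 := hσBt i hi
    show 1 ≤ 1 + κ i x
    rcases fin3_cases (σ i) with h0 | h1 | h2
    · linarith [hσ0 i h0 x hx]
    · exact absurd h1 hne
    · rw [hσ2 i h2 x hx]; simp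
  have hσf : ∀ i, σB i = false → ∀ x ∈ E, 0 < W i x ∧ W i x ≤ 1 := by
    intro i hi x hx
    have h1 : σ i = 1 := hσB1 i hi
    show 0 < 1 + κ i x ∧ 1 + κ i x ≤ 1
    exact ⟨by linarith [hκ1 i x hx], by linarith [hσ1 i h1 x hx]⟩
  -- cell coordinates ↔ engine coordinates: `W − 1 = κ`, `1 − W = −κ`
  have eW1 : ∀ i x, W i x - 1 = κ i x := fun i x => by simp only [W, add_sub_cancel_left]
  have eW2 : ∀ i x, 1 - W i x = -κ i x := fun i x => by simp only [W, sub_add_cancel_left]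
  have hDomEq : ∀ i, (P i).domain =
      if σB i then KZlog.band E (fun _ => 1) (W i) else KZlog.band E (W i) (fun _ => 1) := fun i => by
    rw [hPd i]
    by_cases h : σ i = 1 <;> simp [σB, W, h]
  have hεEq : ∀ i, (if σB i then (1:ℤ) else -1) = (if σ i ≠ 1 then (1:ℤ) else -1) := fun i => by
    by_cases h : σ i = 1 <;> simp [σB, h]
  have hT := wildClose hBR hEo hE d W M hdsa hWsa hWd σB hσt hσf Z m hMm g hgZ hrel qq hqq Nn hNn
    hcoef hsumN
    (fun i hz j h1 h2 => IntegrableOn.congr_fun (hZpow i hz j h1 h2) (fun x _ => by rw [eW1]) hEm)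
    (fun i hz hs j h1 h2 => IntegrableOn.congr_fun (hZpow' i hz (hσB1 i hs) j h1 h2)
      (fun x _ => by rw [eW2]) hEm)
    (fun r i hz => IntegrableOn.congr_fun (hqpow r i hz) (fun x _ => by rw [eW1]) hEm)
    (fun r i hz hs => IntegrableOn.congr_fun (hqpow' r i hz (hσB1 i hs)) (fun x _ => by rw [eW2]) hEm)
    (fun i hz => IntegrableOn.congr_fun (hNpow i hz) (fun x _ => by rw [eW1]) hEm)
    (fun i hz hs => IntegrableOn.congr_fun (hNpow' i hz (hσB1 i hs)) (fun x _ => by rw [eW2]) hEm)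
    hL hintU hintU' hintV hintV' hNlog
    (fun i hs j hj => IntegrableOn.congr_fun (hNtame i (hσBt i hs) j hj) (fun x _ => by rw [eW1]) hEm)
    P hDomEq hPi B hBd hBi
  simpa only [hεEq] using hT

/-- **LOCALISED WILD CERTIFICATE** of a cell: finitely many pairwise disjoint OPEN `ℚ`-semialgebraic pieces
`C s ⊆ E` of full measure in `E` such that, on each piece, the restricted cell is TAME or carries a `WildCellCert`.
(Localisation is the honest form: after cutting `E` into finitely many pieces by sign conditions on `ℚ`-semialgebraic
functions every piece has at most one singular end, where each `κᵢ` has ONE behaviour, and the torus products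
`∏ Wᵢ^{nᵢ} − 1` keep one sign.) -/
def LocalWildCert {q : ℕ} (E : Set (Fin 1 → ℝ)) (c κ : Fin q → (Fin 1 → ℝ) → ℝ) (M : Fin q → ℕ)
    (σ : Fin q → Fin 3) : Prop :=
  ∃ (N : ℕ) (C : Fin N → Set (Fin 1 → ℝ)), (∀ s, IsOpen (C s)) ∧ (∀ s, IsSemialgebraic ℚ (C s)) ∧
    (∀ s, C s ⊆ E) ∧ Pairwise (Function.onFun Disjoint C) ∧ volume (E \ ⋃ s, C s) = 0 ∧
    ∀ s, TameCell (C s) c κ M σ ∨ WildCellCert (C s) c κ M σ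

open scoped ContDiff in
/-- **A locally certified cell closes** (from `BoundaryRigidity` BY NAME): domain additivity over the pieces
(`exists_restrict_parts`; the remainder cylinder is null, `KZ.volume_setOf_init_mem_eq_zero`), then
`cellCloseLS_tame` / `cellCloseLS_wild_of_cert` piece by piece on the restricted data. Binders: those of
`CellCloseLS` verbatim, plus the certificate. -/
theorem cellCloseLS_of_localWildCert
    (hBR : Summit.KontsevichZagierPeriods.LiouvilleUnfolding.LogPrimitiveNL.Negative.BoundaryRigidity)
    (E : Set (Fin 1 → ℝ)) (V : KZ.IntegralRep (1 + 1)) (a₀ : (Fin 1 → ℝ) → ℝ) (q : ℕ)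
    (c κ : Fin q → (Fin 1 → ℝ) → ℝ) (M : Fin q → ℕ) (σ : Fin q → Fin 3)
    (R : ℕ) (f : Fin R → Fin q → ℤ) (qq : Fin R → (Fin 1 → ℝ) → ℝ)
    (_hEo : IsOpen E) (hE : IsSemialgebraic ℚ E)
    (ha₀ : IsSemialgebraicFunOn ℚ E a₀) (ha_sm : ContDiffOn ℝ ∞ a₀ E) (ha₀i : IntegrableOn a₀ E)
    (hc : ∀ i, IsSemialgebraicFunOn ℚ E (c i)) (hc_sm : ∀ i, ContDiffOn ℝ ∞ (c i) E)
    (hκ : ∀ i, IsSemialgebraicFunOn ℚ E (κ i)) (hκ_sm : ∀ i, ContDiffOn ℝ ∞ (κ i) E)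
    (hκ1 : ∀ i, ∀ x ∈ E, -1 < κ i x)
    (hσ0 : ∀ i, σ i = 0 → ∀ x ∈ E, 0 < κ i x) (hσ1 : ∀ i, σ i = 1 → ∀ x ∈ E, κ i x < 0)
    (hσ2 : ∀ i, σ i = 2 → ∀ x ∈ E, κ i x = 0)
    (hint : ∀ i, IntegrableOn (fun z : Fin (1 + 1) → ℝ =>
      c i (Fin.init z) * (z (Fin.last 1) ^ M i / (1 + z (Fin.last 1) * κ i (Fin.init z))))
      {z : Fin (1 + 1) → ℝ | (Fin.init z : Fin 1 → ℝ) ∈ E ∧ z (Fin.last 1) ∈ Set.Ioo 0 1})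
    (hL1 : ∀ i, IntegrableOn (fun x => c i x * ∫ θ in Set.Ioo (0 : ℝ) 1, θ ^ M i / (1 + θ * κ i x)) E)
    (hdom : V.domain = {z : Fin (1 + 1) → ℝ | (Fin.init z : Fin 1 → ℝ) ∈ E ∧ z (Fin.last 1) ∈ Set.Ioo 0 1})
    (hV : Set.EqOn V.integrand (fun z => a₀ (Fin.init z) +
      ∑ i, c i (Fin.init z) * (z (Fin.last 1) ^ M i / (1 + z (Fin.last 1) * κ i (Fin.init z))))
      V.domain)
    (hpoly : ∀ x ∈ E, a₀ x + ∑ i, polyPart (sgnB σ) c κ M i x = 0)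
    (hqq : ∀ r, IsSemialgebraicFunOn ℚ E (qq r))
    (hprod : ∀ r, ∀ x ∈ E, ∏ i, (1 + κ i x) ^ (f r i) = 1)
    (hcoef : ∀ i, ∀ x ∈ E, logCoef (sgnB σ) c κ M i x = ∑ r, qq r x * (f r i : ℝ))
    (hloc : LocalWildCert E c κ M σ) :
    KZ.of V ∈ KZ.relations := by
  classical
  obtain ⟨N, C, hCo, hCsa, hCE, hCdisj, hnull, hTW⟩ := hloc
  -- open cylinders over subsets of the base
  let cyl : Set (Fin 1 → ℝ) → Set (Fin (1 + 1) → ℝ) := fun S =>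
    {z : Fin (1 + 1) → ℝ | (Fin.init z : Fin 1 → ℝ) ∈ S ∧ z (Fin.last 1) ∈ Set.Ioo 0 1}
  have hcyl_sa : ∀ S, IsSemialgebraic ℚ S → IsSemialgebraic ℚ (cyl S) := fun S hS =>
    RTerm.isSemialgebraic_cyl hS
  have hUsa : IsSemialgebraic ℚ (⋃ s, C s) := by
    simpa using IsSemialgebraic.biUnion Finset.univ C fun s _ => hCsa s
  have hUE : (⋃ s, C s) ⊆ E := iUnion_subset hCE
  have hrem : IsSemialgebraic ℚ (E \ ⋃ s, C s) := hE.diff hUsa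
  -- (1) `V ≡ V|cyl(⋃ C) + V|cyl(E ∖ ⋃ C)`, the second piece null
  have hsR : cyl (⋃ s, C s) ⊆ V.domain := by
    rw [hdom]; exact fun z hz => ⟨hUE hz.1, hz.2⟩
  have htR : cyl (E \ ⋃ s, C s) ⊆ V.domain := by
    rw [hdom]; exact fun z hz => ⟨hz.1.1, hz.2⟩
  have hrel₁ : KZ.of V - KZ.of (V.restrict _ (hcyl_sa _ hUsa) hsR) -
      KZ.of (V.restrict _ (hcyl_sa _ hrem) htR) ∈ KZ.relations := by
    refine KZ.domainAddRel_subset_relations ⟨1 + 1, V, V.restrict _ (hcyl_sa _ hUsa) hsR,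
      V.restrict _ (hcyl_sa _ hrem) htR, ?_, ?_, fun _ _ => rfl, fun _ _ => rfl, rfl⟩
    · rw [KZ.IntegralRep.domain_restrict, KZ.IntegralRep.domain_restrict, hdom]
      ext z
      simp only [cyl, mem_setOf_eq, mem_union, Set.mem_sdiff]
      constructor
      · rintro ⟨hzE, hzt⟩
        by_cases h : (Fin.init z : Fin 1 → ℝ) ∈ ⋃ s, C s
        · exact Or.inl ⟨h, hzt⟩
        · exact Or.inr ⟨⟨hzE, h⟩, hzt⟩
      · rintro (⟨h, hzt⟩ | ⟨⟨hzE, -⟩, hzt⟩)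
        · exact ⟨hUE h, hzt⟩
        · exact ⟨hzE, hzt⟩
    · rw [KZ.IntegralRep.domain_restrict, KZ.IntegralRep.domain_restrict]
      exact measure_mono_null (fun z hz => hz.2.1) (KZ.volume_setOf_init_mem_eq_zero hnull)
  have hV₀ : KZ.of (V.restrict _ (hcyl_sa _ hrem) htR) ∈ KZ.relations := by
    refine KZ.of_mem_relations_of_volume_eq_zero _ ?_
    rw [KZ.IntegralRep.domain_restrict]
    exact measure_mono_null (fun z hz => hz.1) (KZ.volume_setOf_init_mem_eq_zero hnull)
  -- (2) `V|cyl(⋃ C) ≡ Σ_s V|cyl(C s)`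
  have hDdisj : Pairwise (Function.onFun Disjoint fun s => cyl (C s)) := fun i j hij =>
    Set.disjoint_left.mpr fun z hzi hzj => Set.disjoint_left.mp (hCdisj hij) hzi.1 hzj.1
  obtain ⟨Vc, hVcd, hVci, hrel₂⟩ := exists_restrict_parts N (fun s => cyl (C s))
    (fun s => hcyl_sa _ (hCsa s)) hDdisj (V.restrict _ (hcyl_sa _ hUsa) hsR) (by
      rw [KZ.IntegralRep.domain_restrict]
      ext z
      simp only [cyl, mem_setOf_eq, mem_iUnion]
      constructor
      · rintro ⟨⟨s, hs⟩, hzt⟩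
        exact ⟨s, hs, hzt⟩
      · rintro ⟨s, hs, hzt⟩
        exact ⟨⟨s, hs⟩, hzt⟩)
  -- (3) each piece closes
  have hpiece : ∀ s, KZ.of (Vc s) ∈ KZ.relations := by
    intro s
    have hS : C s ⊆ E := hCE s
    have hV_s : Set.EqOn (Vc s).integrand (fun z => a₀ (Fin.init z) +
        ∑ i, c i (Fin.init z) * (z (Fin.last 1) ^ M i / (1 + z (Fin.last 1) * κ i (Fin.init z))))
        (Vc s).domain := by
      intro z hz
      rw [hVci s, KZ.IntegralRep.integrand_restrict]
      refine hV ?_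
      rw [hdom]
      rw [hVcd s] at hz
      exact ⟨hS hz.1, hz.2⟩
    rcases hTW s with ht | hw
    · exact cellCloseLS_tame hBR (C s) (Vc s) a₀ q c κ M σ R f qq (hCo s) (hCsa s)
        (ha₀.mono hS (hCsa s)) (ha_sm.mono hS) (ha₀i.mono_set hS)
        (fun i => (hc i).mono hS (hCsa s)) (fun i => (hc_sm i).mono hS)
        (fun i => (hκ i).mono hS (hCsa s)) (fun i => (hκ_sm i).mono hS)
        (fun i x hx => hκ1 i x (hS hx)) (fun i h x hx => hσ0 i h x (hS hx))
        (fun i h x hx => hσ1 i h x (hS hx)) (fun i h x hx => hσ2 i h x (hS hx))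
        (fun i => (hint i).mono_set fun z hz => ⟨hS hz.1, hz.2⟩) (fun i => (hL1 i).mono_set hS)
        (hVcd s) hV_s (fun x hx => hpoly x (hS hx)) (fun r => (hqq r).mono hS (hCsa s))
        (fun r x hx => hprod r x (hS hx)) (fun i x hx => hcoef i x (hS hx)) ht.1 ht.2
    · exact cellCloseLS_wild_of_cert hBR (C s) (Vc s) a₀ q c κ M σ (hCo s) (hCsa s)
        (ha₀.mono hS (hCsa s)) (ha_sm.mono hS) (ha₀i.mono_set hS)
        (fun i => (hc i).mono hS (hCsa s)) (fun i => (hc_sm i).mono hS)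
        (fun i => (hκ i).mono hS (hCsa s)) (fun i => (hκ_sm i).mono hS)
        (fun i x hx => hκ1 i x (hS hx)) (fun i h x hx => hσ0 i h x (hS hx))
        (fun i h x hx => hσ1 i h x (hS hx)) (fun i h x hx => hσ2 i h x (hS hx))
        (fun i => (hint i).mono_set fun z hz => ⟨hS hz.1, hz.2⟩) (fun i => (hL1 i).mono_set hS)
        (hVcd s) hV_s (fun x hx => hpoly x (hS hx)) hw
  -- (4) assemble
  have e : KZ.of V = (KZ.of V - KZ.of (V.restrict _ (hcyl_sa _ hUsa) hsR) -
      KZ.of (V.restrict _ (hcyl_sa _ hrem) htR)) + KZ.of (V.restrict _ (hcyl_sa _ hrem) htR) +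
      (KZ.of (V.restrict _ (hcyl_sa _ hUsa) hsR) - ∑ s, KZ.of (Vc s)) + ∑ s, KZ.of (Vc s) := by
    abel
  rw [e]
  exact add_mem (add_mem (add_mem hrel₁ hV₀) hrel₂) (sum_mem fun s _ => hpiece s)

/-- The TAME class lies inside the certificate class (one piece, `C 0 = E`). -/
theorem localWildCert_of_tameCell {q : ℕ} {E : Set (Fin 1 → ℝ)} {c κ : Fin q → (Fin 1 → ℝ) → ℝ}
    {M : Fin q → ℕ} {σ : Fin q → Fin 3} (hEo : IsOpen E) (hE : IsSemialgebraic ℚ E)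
    (ht : TameCell E c κ M σ) : LocalWildCert E c κ M σ := by
  refine ⟨1, fun _ => E, fun _ => hEo, fun _ => hE, fun _ => Subset.rfl, ?_, ?_, fun _ => Or.inl ht⟩
  · intro i j hij
    exact absurd (Subsingleton.elim i j) hij
  · have h : E \ ⋃ _s : Fin 1, E = ∅ := by
      rw [Set.iUnion_const, sdiff_self]
    rw [h, measure_empty]

open scoped ContDiff in
/-- **`CellLocalWildCert`** — the typed residual of the RUNG `CylKernelZeroLog` after g11: EVERY cell of `CellCloseLS`
(binders verbatim; no tame/wild case hypothesis — the class is padding-invariant, tame cells being certified by one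
piece, `localWildCert_of_tameCell`) admits a LOCALISED WILD CERTIFICATE.  Pure one-variable real analysis of
`ℚ`-semialgebraic functions + the lattice split §3ae; no KZ calculus. [OPEN — the g12 target; UNDECIDED · ATTACKABLE-NOW] -/
def CellLocalWildCert : Prop :=
  ∀ (E : Set (Fin 1 → ℝ)) (V : KZ.IntegralRep (1 + 1)) (a₀ : (Fin 1 → ℝ) → ℝ) (q : ℕ)
    (c κ : Fin q → (Fin 1 → ℝ) → ℝ) (M : Fin q → ℕ) (σ : Fin q → Fin 3)
    (R : ℕ) (f : Fin R → Fin q → ℤ) (qq : Fin R → (Fin 1 → ℝ) → ℝ),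
    IsOpen E → IsSemialgebraic ℚ E →
    IsSemialgebraicFunOn ℚ E a₀ → ContDiffOn ℝ ∞ a₀ E → IntegrableOn a₀ E →
    (∀ i, IsSemialgebraicFunOn ℚ E (c i)) → (∀ i, ContDiffOn ℝ ∞ (c i) E) →
    (∀ i, IsSemialgebraicFunOn ℚ E (κ i)) → (∀ i, ContDiffOn ℝ ∞ (κ i) E) →
    (∀ i, ∀ x ∈ E, -1 < κ i x) →
    (∀ i, σ i = 0 → ∀ x ∈ E, 0 < κ i x) → (∀ i, σ i = 1 → ∀ x ∈ E, κ i x < 0) →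
    (∀ i, σ i = 2 → ∀ x ∈ E, κ i x = 0) →
    (∀ i, IntegrableOn (fun z : Fin (1 + 1) → ℝ =>
      c i (Fin.init z) * (z (Fin.last 1) ^ M i / (1 + z (Fin.last 1) * κ i (Fin.init z))))
      {z : Fin (1 + 1) → ℝ | (Fin.init z : Fin 1 → ℝ) ∈ E ∧ z (Fin.last 1) ∈ Set.Ioo 0 1}) →
    (∀ i, IntegrableOn (fun x => c i x * ∫ θ in Set.Ioo (0 : ℝ) 1, θ ^ M i / (1 + θ * κ i x)) E) →
    V.domain = {z : Fin (1 + 1) → ℝ | (Fin.init z : Fin 1 → ℝ) ∈ E ∧ z (Fin.last 1) ∈ Set.Ioo 0 1} →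
    Set.EqOn V.integrand (fun z => a₀ (Fin.init z) +
      ∑ i, c i (Fin.init z) * (z (Fin.last 1) ^ M i / (1 + z (Fin.last 1) * κ i (Fin.init z))))
      V.domain →
    (∀ x ∈ E, a₀ x + ∑ i, polyPart (sgnB σ) c κ M i x = 0) →
    (∀ r, IsSemialgebraicFunOn ℚ E (qq r)) →
    (∀ r, ∀ x ∈ E, ∏ i, (1 + κ i x) ^ (f r i) = 1) →
    (∀ i, ∀ x ∈ E, logCoef (sgnB σ) c κ M i x = ∑ r, qq r x * (f r i : ℝ)) →
    LocalWildCert E c κ M σ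

/-- **`BoundaryRigidity → CellLocalWildCert → CellCloseLS` (PROVED).** -/
theorem cellCloseLS_of_cellLocalWildCert
    (hBR : Summit.KontsevichZagierPeriods.LiouvilleUnfolding.LogPrimitiveNL.Negative.BoundaryRigidity)
    (h : CellLocalWildCert) : CellCloseLS :=
  fun E V a₀ q c κ M σ R f qq hEo hE ha₀ ha_sm ha₀i hc hc_sm hκ hκ_sm hκ1 hσ0 hσ1 hσ2 hint hL1 hdom hV hpoly hqq
      hprod hcoef =>
    cellCloseLS_of_localWildCert hBR E V a₀ q c κ M σ R f qq hEo hE ha₀ ha_sm ha₀i hc hc_sm hκ hκ_sm hκ1 hσ0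
      hσ1 hσ2 hint hL1 hdom hV hpoly hqq hprod hcoef
      (h E V a₀ q c κ M σ R f qq hEo hE ha₀ ha_sm ha₀i hc hc_sm hκ hκ_sm hκ1 hσ0 hσ1 hσ2 hint hL1 hdom hV hpoly
        hqq hprod hcoef)

/-- **The glue spine of the RUNG after g11 addendum 2 (PROVED, padding-invariant):
`LogStructure → BoundaryRigidity → CellLocalWildCert → CylKernelZeroLog`.** -/
theorem cylKernelZeroLog_of_localWildCert (hLS : LogStructure)
    (hBR : Summit.KontsevichZagierPeriods.LiouvilleUnfolding.LogPrimitiveNL.Negative.BoundaryRigidity)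
    (h : CellLocalWildCert) : CylKernelZeroLog :=
  cylKernelZeroLog_of_cellCloseLS hLS (cellCloseLS_of_cellLocalWildCert hBR h)

/-! ### §3ak The critic's standing test §B (bus row g4-4) is CERTIFIED in the kernel (g11)
Test §B: `E = G = (0,1)`, `κ = (x, −x/(1+x))` (`MixedInstance.κP/κN`), `M = (1,1)`, `σ = (0,1)`,
`c = (−1, −1/(1+x)²)` (regularised coefficients `d_i = c_i/κ_i² = (−1/x², −1/x²)`, `qq = x⁻²`, `f = (1,1)`,
`∏ (1+κ_i)^{f_i} = (1+x)·(1/(1+x)) = 1`).  The theorem `TestB.wildCellCert : WildCellCert G c κ M σ` exhibits the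
twenty side conditions of `wildClose` with `Z = {1,2}` (raise BOTH indices), `m = 1`, ONE relation `g = (1,1)`,
`qq = x⁻²`, `Ñ = 0`: every integrand that `wildClose` forms is one of `±1, ±1/(1+x), ±1/(1+x)², 0` on `(0,1)`,
hence bounded semialgebraic, hence integrable (`integrableOn_of_abs_le`).  Consequently (by `localWildCert` with the
one-piece partition and `cellCloseLS_of_localWildCert`) the honest representation of test §B closes from
`BoundaryRigidity` BY NAME — no appeal to the residual is needed for this instance. -/

namespace TestB

open DegenerateInstance MixedInstance

/-- `c = (−1, −1/(1+x)²)`. -/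
def c : Fin 2 → (Fin 1 → ℝ) → ℝ := ![fun _ => -1, fun x => -1 / (1 + x 0) ^ 2]
/-- `κ = (x, −x/(1+x))`. -/
def κ : Fin 2 → (Fin 1 → ℝ) → ℝ := ![κP, κN]
/-- `M = (1, 1)`. -/
def M : Fin 2 → ℕ := fun _ => 1
/-- `σ = (0, 1)` (`κ₁ > 0`, `κ₂ < 0`). -/
def σ : Fin 2 → Fin 3 := ![0, 1]

end TestB
end CylLog
end RegularisedLogLayer
end Summit.KontsevichZagierPeriods.RootDecompRelativeModAbsolute.Rung30571
end
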